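import Summits.QuantumFields.YangMills.Theorems.BalabanUVNodesN15CurvedGluingSpeciesCommutator
import HarnessLib

/-!
# Route «BalabanUVNodes» (cluster K4 «SpineRates»), Track-A DAG node N15 = NE2, BACKGROUND LAYER — THE ADJOINT ROW OF THE SPECIES COMMUTATOR: `G∘[V, M_h]` for
# `V = M_C + Σ_μ(M_{A⁺_μ}∇⁺_μ + M_{A⁻_μ}∇⁻_μ)` EXACTLY through the cube's RIGHT entries `G`, `G∘∇^±_μ`, and its (2.134)-shaped letter (the transposed arrangement (2.91)ᵀ of dag-n15-c FILE 49)

Cell `pub-ymgap`, seat `pub-ymgap-dag-n15-w3` (WIDTH SEAT 3∕3 on node N15, director-ym №197 ∕ HUMAN RULING D-0149; plan `W-SEAT-START-LIST.md` §n15 item 3 — fourteenth piece: the `W`-row of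
dag-n15-c's ADJOINT gluing arrangement (FILE 49 `hasMaj_comp_commOp_lapOp`'s `hW`, `hasMaj_remainderL`'s `hKc`) for `W = ±V`).  `bears_on: R4∕N15 · K3⁷ SpineGivenEndpointR13SepCoPH
(stmt-QuantumFields-20544)`.  Filed `--kind proof --supports stmt-QuantumFields-20544 --as helper` — COUNT-NEUTRAL.  Theorems only; 0 `sorry`.  Imports BY NAME file 12
`…N15CurvedGluingSpeciesCommutator` (`commOp_eq_zero_of_comm`, `commOp_comp_eq_of_comm`, `mmulOp_comp_mulOp_fst`; through it dag-n15-c FILES 45∕46 `commOp`, `commOp_add_left`, `commOp_fsum_left`,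
`hasMaj_comp_diag`, `hasMaj_fsum`, lit `B6Prop26Gluing.mulOp`∕`ind`, FILE 28 `speciesOpM`, n15-b `mmulOp`∕`liftEquiv`∕`liftBlk`∕`hasMaj_mmulOp`, `fgrad`∕`bgrad`); nothing in the tree is modified.

WHY.  [Balaban1984PropagatorsII] (2.91) has a transpose: the cube parametrix is a two-sided approximate inverse, and the second resummation `(1 − R̃)⁻¹G₀` with `R̃ = Σ_□ M_{h_□}G_□[Δ_a, M_{h_□}]`
(dag-n15-c FILE 49 `remainderL`) carries entry 2 of (3.42) (FILE 50 `gluedOps`, `GluedLetters`' `RL` rows).  Its per-cube letter needs `G_□∘[Δ_a, M_{h_□}] ≤ 1_S1_S·θ₀e^{−δd}` through the cube's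
RIGHT entries `G_□`, `G_□∘∇_μ`, `G_□∘∇⁻_μ` (FILE 49 `hasMaj_comp_commOp_lapOp` and its covariant twin FILE 53 `hasMaj_comp_commOp_covLapM`, with the `W`-part displayed as
`hW : G∘[W, M_h] ≤ 1_S1_S·θ_We^{−δd}`).  For the first-order species `W ∋ −V(c, a)` of (3.52)–(3.53) ([Balaban1985BackgroundPropagators] p. 400) file 12 gave the LEFT row `[V, M_h]∘G`; THIS
FILE gives the RIGHT one.  Mechanism: `[V, M_h] = Σ_μ(M_{A⁺}[∇⁺, M_h] + M_{A⁻}[∇⁻, M_h])` (the coefficients commute with `M_h`), and pointwise `([∇⁺, M_h]f)(y) = (∇⁺h)(y)·f(τy)`, so the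
matrix coefficient standing between `G` and the bracket moves to the RIGHT of the quotient for free: `M_A[∇⁺, M_h] = M_{∇⁻h·(A∘τ⁻¹)} + ∇⁺∘M_{δ⁻h·(A∘τ⁻¹)}` (`δ⁻h = h − h∘τ⁻¹`; NO derivative of
the coefficient appears) — whence `G∘[V, M_h] = Σ_μ[G∘M_{∇⁻h·(A⁺∘τ⁻¹)} + (G∘∇⁺)∘M_{δ⁻h·(A⁺∘τ⁻¹)} + G∘M_{∇⁺h·(A⁻∘τ)} − (G∘∇⁻)∘M_{δ⁺h·(A⁻∘τ)}]`: only the right entries `G`, `G∘∇^±` followed by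
DIAGONAL factors, with the same four letters as the left row — `c₁ = |∇^±h|`, `c₀ = |h∘τ − h|`, the coefficient rows `r_A`: `G∘[V, M_h] ≤ 1_S(y)1_S(y′)·|J|·2·r_A(c₁β + c₀β₁)·e^{−δd}`.

* §1 exact lattice algebra: `commOp_fgrad`, `commOp_bgrad` ((1.126)–(1.128)-type Leibniz rules as operator identities), `comp_commOp_neg`, `comp_finset_sum`, ★ `mmulOp_comp_commOp_fgrad` ∕
  ★ `mmulOp_comp_commOp_bgrad` (the coefficient passes the bracket to the right of the quotient), ★ `commOp_speciesOpM` (`[V, M_h] = Σ_μ(M_{A⁺}[∇⁺_μ, M_h] + M_{A⁻}[∇⁻_μ, M_h])`), ★★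
  `comp_commOp_speciesOpM` (the exact four-term expansion of `G∘[V, M_h]` per direction);
* §2 `sum_abs_smul_row_le` (`Σ_k|(w·A)_{ik}| ≤ c·r_A`);
* §3 `hasMaj_comp_mmulOp_loc` (`T∘M_B ≤ 1_S1_S·βm·e^{−δd}`), ★★ `hasMaj_comp_commOp_speciesOpM` — FILE 49∕53's `hW` row for `W = V` from the cube's right entries `G ≤ 1_S1_S·βe^{−δd}`,
  `G∘∇^±_μ ≤ 1_S1_S·β₁e^{−δd}`; ★ `hasMaj_comp_commOp_neg_speciesOpM` (`W = −V`).

HONEST FRAMING ∕ LIMITS.  Lattice Leibniz bookkeeping in dag-n15-c's row currency (no estimate); the cube's right entries and every letter are DISPLAYED ((3.35)–(3.37) p. 396, (3.52)–(3.53)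
p. 400, (2.91)–(2.92) p. 239, (2.134) p. 247 = SHAPES ∕ MECHANISM); the two-grid η-defect of this adjoint row (FILE 53's `r_W`) is NOT in this file (successor); the `Q*aQ`∕`DRD*` adjoint
rows are dag-n15-c's ∕ open; nothing of [B6]∕[B9] asserted.  NE2⁺ NOT PRINTED, NOT proved; N15 NOT discharged; counts of record UNMOVED (typed 28∕28 · discharged 5∕27); one finite 𝕋⁴ at fixed ε — NOT infinite
volume, NOT OS on ℝ⁴, NOT a mass gap, NOT Clay; R4 closes the conditional finite-𝕋⁴ rung `BalabanLadder.UV` only.  Restate-immune (no Theses import).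
-/

set_option autoImplicit false

noncomputable section
open scoped BigOperators
open Finset

namespace Summit.QuantumFields.YangMills.BalabanUVNodes.N15.CurvedSpecies

open Literature.MathematicalPhysics.QuantumFieldTheory.Balaban1983to89
open Literature.MathematicalPhysics.QuantumFieldTheory.Balaban1983to89.B11SectG (BlockNorm HasMaj)
open Literature.MathematicalPhysics.QuantumFieldTheory.Balaban1983to89.T4EtaRateCoeffDefect (diagK diagK_nonneg)
open Literature.MathematicalPhysics.QuantumFieldTheory.Balaban1983to89.B6Prop26Gluing (mulOp mulOp_apply ind ind_nonneg)
open Summit.QuantumFields.YangMills.BalabanUVNodes.N15.MatrixSpecies (mmulOp mmulOp_apply liftBlk liftEquiv liftEquiv_apply liftEquiv_symm_apply hasMaj_mmulOp)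
open Summit.QuantumFields.YangMills.BalabanUVNodes.N15.BackgroundLayer (fgrad bgrad fgrad_apply bgrad_apply speciesOpM)
open Summit.QuantumFields.YangMills.BalabanUVNodes.N15.Gluing (commOp commOp_add_left commOp_fsum_left hasMaj_comp_diag hasMaj_fsum)

/-! ## §1 Exact lattice algebra: the Leibniz rules as operator identities; a matrix coefficient between `G` and `[∇^±, M_h]` moves to the RIGHT of the quotient for free -/

section Algebra

variable {Y : Type}

/-- THE LEIBNIZ RULE, FORWARD, AS AN OPERATOR IDENTITY: `[∇⁺, M_h] = M_{∇⁺h} + M_{h∘e − h}∘∇⁺`. [cite: Balaban1984PropagatorsII, p.239 («the formulas (1.126)–(1.128)»: shape)] -/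
theorem commOp_fgrad (n : ℝ) (e : Y ≃ Y) (h : Y → ℝ) : commOp (fgrad n e) h = mulOp (fgrad n e h) + mulOp (fun y => h (e y) - h y) ∘ₗ fgrad n e := by
  refine LinearMap.ext fun f => funext fun y => ?_
  simp only [commOp, LinearMap.sub_apply, LinearMap.comp_apply, LinearMap.add_apply, Pi.add_apply, Pi.sub_apply, mulOp_apply, fgrad_apply]
  ring

/-- THE LEIBNIZ RULE, BACKWARD: `[∇⁻, M_h] = M_{∇⁻h} − M_{h − h∘e⁻¹}∘∇⁻`. [cite: Balaban1984PropagatorsII, p.239 (shape)] -/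
theorem commOp_bgrad (n : ℝ) (e : Y ≃ Y) (h : Y → ℝ) : commOp (bgrad n e) h = mulOp (bgrad n e h) - mulOp (fun y => h y - h (e.symm y)) ∘ₗ bgrad n e := by
  refine LinearMap.ext fun f => funext fun y => ?_
  simp only [commOp, LinearMap.sub_apply, LinearMap.comp_apply, Pi.sub_apply, mulOp_apply, bgrad_apply]
  ring

/-- `(−Δ)`: `G∘[−Δ, M_a] = −(G∘[Δ, M_a])`. [folklore] -/
theorem comp_commOp_neg (Δ G : (Y → ℝ) →ₗ[ℝ] (Y → ℝ)) (a : Y → ℝ) : G ∘ₗ commOp (-Δ) a = -(G ∘ₗ commOp Δ a) := by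
  simp only [commOp, LinearMap.neg_comp, LinearMap.comp_neg, LinearMap.comp_sub]
  abel

/-- `G ∘ Σ_μ T_μ = Σ_μ G ∘ T_μ`. [folklore] -/
theorem comp_finset_sum {J : Type} [Fintype J] (G : (Y → ℝ) →ₗ[ℝ] (Y → ℝ)) (T : J → (Y → ℝ) →ₗ[ℝ] (Y → ℝ)) : G ∘ₗ (∑ μ, T μ) = ∑ μ, G ∘ₗ T μ :=
  LinearMap.ext fun v => by simp only [LinearMap.comp_apply, LinearMap.coe_sum, Finset.sum_apply, map_sum]

variable {X ι J : Type} [Fintype ι]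

/-- ★ A MATRIX COEFFICIENT BETWEEN `G` AND THE FORWARD LEIBNIZ BRACKET MOVES RIGHT FOR FREE: `M_A∘[∇⁺_e, M_h] = M_{∇⁻_e h·(A∘e⁻¹)} + ∇⁺_e∘M_{(h − h∘e⁻¹)·(A∘e⁻¹)}` for ι-constant `h` —
pointwise `([∇⁺, M_h]f)(y) = (∇⁺h)(y)·f(ey)` and the shift passes the diagonal coefficient to `e⁻¹y`; NO derivative of `A` appears. [cite: Balaban1984PropagatorsII, (2.91)–(2.92) p.239 (mechanism, transposed); (1.126)–(1.128) (shape)] -/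
theorem mmulOp_comp_commOp_fgrad (n : ℝ) (e : X ≃ X) (A : X → Matrix ι ι ℝ) (hX : X → ℝ) :
    mmulOp A ∘ₗ commOp (fgrad n (liftEquiv e ι)) (fun p : X × ι => hX p.1) =
      mmulOp (fun x => bgrad n e hX x • A (e.symm x)) + fgrad n (liftEquiv e ι) ∘ₗ mmulOp (fun x => (hX x - hX (e.symm x)) • A (e.symm x)) := by
  refine LinearMap.ext fun f => funext fun p => ?_
  simp only [commOp, LinearMap.comp_apply, LinearMap.sub_apply, LinearMap.add_apply, Pi.sub_apply, Pi.add_apply, mmulOp_apply, mulOp_apply, fgrad_apply, bgrad_apply,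
    liftEquiv_apply, Equiv.symm_apply_apply, Matrix.smul_apply, smul_eq_mul, mul_sub, Finset.mul_sum, ← Finset.sum_sub_distrib, ← Finset.sum_add_distrib]
  exact Finset.sum_congr rfl fun j _ => by ring

/-- ★ THE BACKWARD TWIN: `M_A∘[∇⁻_e, M_h] = M_{∇⁺_e h·(A∘e)} − ∇⁻_e∘M_{(h∘e − h)·(A∘e)}` for ι-constant `h` (`([∇⁻, M_h]f)(y) = (∇⁻h)(y)·f(e⁻¹y)`). [cite: Balaban1984PropagatorsII, (2.91)–(2.92) p.239 (mechanism, transposed)] -/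
theorem mmulOp_comp_commOp_bgrad (n : ℝ) (e : X ≃ X) (A : X → Matrix ι ι ℝ) (hX : X → ℝ) :
    mmulOp A ∘ₗ commOp (bgrad n (liftEquiv e ι)) (fun p : X × ι => hX p.1) =
      mmulOp (fun x => fgrad n e hX x • A (e x)) - bgrad n (liftEquiv e ι) ∘ₗ mmulOp (fun x => (hX (e x) - hX x) • A (e x)) := by
  refine LinearMap.ext fun f => funext fun p => ?_
  simp only [commOp, LinearMap.comp_apply, LinearMap.sub_apply, Pi.sub_apply, mmulOp_apply, mulOp_apply, fgrad_apply, bgrad_apply, liftEquiv_symm_apply, Equiv.apply_symm_apply,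
    Matrix.smul_apply, smul_eq_mul, mul_sub, Finset.mul_sum, ← Finset.sum_sub_distrib]
  exact Finset.sum_congr rfl fun j _ => by ring

variable [Fintype J] (τ : J → X ≃ X) (n : ℝ) (C : X → Matrix ι ι ℝ) (A : J ⊕ J → X → Matrix ι ι ℝ) (hX : X → ℝ) (G : (X × ι → ℝ) →ₗ[ℝ] (X × ι → ℝ))

/-- ★ `[V, M_h] = Σ_μ(M_{A⁺_μ}∘[∇⁺_μ, M_h] + M_{A⁻_μ}∘[∇⁻_μ, M_h])` for ι-constant `h` (`[M_C, M_h] = 0`, the coefficients commute with `M_h`). [cite: Balaban1985BackgroundPropagators, (3.52) p.400 (V: shape)] -/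
theorem commOp_speciesOpM :
    commOp (speciesOpM τ n C A) (fun p : X × ι => hX p.1) =
      ∑ μ, (mmulOp (A (Sum.inl μ)) ∘ₗ commOp (fgrad n (liftEquiv (τ μ) ι)) (fun p : X × ι => hX p.1) +
        mmulOp (A (Sum.inr μ)) ∘ₗ commOp (bgrad n (liftEquiv (τ μ) ι)) (fun p : X × ι => hX p.1)) := by
  have hC : commOp (mmulOp C) (fun p : X × ι => hX p.1) = 0 := commOp_eq_zero_of_comm (mmulOp_comp_mulOp_fst C hX)
  unfold speciesOpM
  rw [commOp_add_left, hC, zero_add, commOp_fsum_left]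
  exact Finset.sum_congr rfl fun μ _ => by
    rw [commOp_add_left, commOp_comp_eq_of_comm (mmulOp_comp_mulOp_fst _ hX), commOp_comp_eq_of_comm (mmulOp_comp_mulOp_fst _ hX)]

/-- ★★ **THE ADJOINT SPECIES COMMUTATOR, EXACTLY, THROUGH RIGHT ENTRIES**: `G∘[V, M_h] = Σ_μ [G∘M_{∇⁻_μh·(A⁺_μ∘τ_μ⁻¹)} + (G∘∇⁺_μ)∘M_{δ⁻_μh·(A⁺_μ∘τ_μ⁻¹)} + G∘M_{∇⁺_μh·(A⁻_μ∘τ_μ)} −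
(G∘∇⁻_μ)∘M_{δ⁺_μh·(A⁻_μ∘τ_μ)}]` (`δ⁻h = h − h∘τ⁻¹`, `δ⁺h = h∘τ − h`) — only the cube's right entries `G`, `G∘∇^±_μ` followed by DIAGONAL factors; the same four letters as file 12's left row.
[cite: Balaban1984PropagatorsII, (2.91)–(2.92) p.239, (2.134) p.247 (mechanism, transposed); Balaban1985BackgroundPropagators, (3.52)–(3.53) p.400 (V: shape)] -/
theorem comp_commOp_speciesOpM :
    G ∘ₗ commOp (speciesOpM τ n C A) (fun p : X × ι => hX p.1) =
      ∑ μ, (G ∘ₗ mmulOp (fun x => bgrad n (τ μ) hX x • A (Sum.inl μ) ((τ μ).symm x)) +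
          (G ∘ₗ fgrad n (liftEquiv (τ μ) ι)) ∘ₗ mmulOp (fun x => (hX x - hX ((τ μ).symm x)) • A (Sum.inl μ) ((τ μ).symm x)) +
        (G ∘ₗ mmulOp (fun x => fgrad n (τ μ) hX x • A (Sum.inr μ) (τ μ x)) -
          (G ∘ₗ bgrad n (liftEquiv (τ μ) ι)) ∘ₗ mmulOp (fun x => (hX (τ μ x) - hX x) • A (Sum.inr μ) (τ μ x)))) := by
  rw [commOp_speciesOpM, comp_finset_sum]
  exact Finset.sum_congr rfl fun μ _ => by
    rw [LinearMap.comp_add, mmulOp_comp_commOp_fgrad, mmulOp_comp_commOp_bgrad, LinearMap.comp_add, LinearMap.comp_sub, LinearMap.comp_assoc, LinearMap.comp_assoc]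

end Algebra

/-! ## §2 Row letter of a scalar-times-matrix coefficient -/

section Rows

variable {ι : Type} [Fintype ι]

/-- `Σ_k|(w·A)_{ik}| = |w|·Σ_k|A_{ik}| ≤ c·r`. [folklore] -/
theorem sum_abs_smul_row_le {w c r : ℝ} {A : Matrix ι ι ℝ} (hc : 0 ≤ c) (hw : |w| ≤ c) (i : ι) (hA : ∑ k, |A i k| ≤ r) : ∑ k, |(w • A) i k| ≤ c * r := by
  have hs : 0 ≤ ∑ k, |A i k| := Finset.sum_nonneg fun _ _ => abs_nonneg _
  calc ∑ k, |(w • A) i k| = |w| * ∑ k, |A i k| := by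
        rw [Finset.mul_sum]
        exact Finset.sum_congr rfl fun k _ => by rw [Matrix.smul_apply, smul_eq_mul, abs_mul]
    _ ≤ c * r := mul_le_mul hw hA hs hc

end Rows

/-! ## §3 The (2.134)-shaped letter of the adjoint species commutator from the cube's right entries -/

section Row

variable {X ι J : Type} [Fintype X] [Fintype ι] [Fintype J] {g : B6.Geometry} (blk : X → g.Site)
variable (τ : J → X ≃ X) (n : ℝ) (C : X → Matrix ι ι ℝ) (A : J ⊕ J → X → Matrix ι ι ℝ) (hX : X → ℝ) (G : (X × ι → ℝ) →ₗ[ℝ] (X × ι → ℝ))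

/-- `T∘M_B ≤ 1_S1_S·(β·m)e^{−δd}` from `T ≤ 1_S1_S·βe^{−δd}` (`β ≥ 0`) and rows `Σ_k|B(x)_{ik}| ≤ m` (a diagonal factor on the right costs no rate). [folklore] -/
theorem hasMaj_comp_mmulOp_loc {T : (X × ι → ℝ) →ₗ[ℝ] (X × ι → ℝ)} {B : X → Matrix ι ι ℝ} {S : Set g.Site} {β m δ : ℝ} (hβ : 0 ≤ β) (hm : 0 ≤ m) (hB : ∀ x i, ∑ k, |B x i k| ≤ m)
    (hT : HasMaj (BlockNorm.ofBlocks g (liftBlk blk ι)) (BlockNorm.ofBlocks g (liftBlk blk ι)) T (fun y y' => ind S y * ind S y' * (β * Real.exp (-(δ * g.dist y y'))))) :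
    HasMaj (BlockNorm.ofBlocks g (liftBlk blk ι)) (BlockNorm.ofBlocks g (liftBlk blk ι)) (T ∘ₗ mmulOp B) (fun y y' => ind S y * ind S y' * (β * m * Real.exp (-(δ * g.dist y y')))) := by
  have hnn : ∀ y y' : g.Site, 0 ≤ ind S y * ind S y' * (β * Real.exp (-(δ * g.dist y y'))) :=
    fun y y' => mul_nonneg (mul_nonneg (ind_nonneg _ _) (ind_nonneg _ _)) (mul_nonneg hβ (Real.exp_nonneg _))
  refine (hasMaj_comp_diag (liftBlk blk ι) hnn hT (hasMaj_mmulOp blk (m := fun _ => m) (fun _ => hm) hB)).mono fun y y' => le_of_eq ?_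
  ring

/-- ★★ **dag-n15-c FILE 49 ∕ FILE 53's `hW` ROW FOR `W = V` — THE ADJOINT SPECIES COMMUTATOR FROM THE CUBE's RIGHT ENTRIES.**  Data: `G ≤ 1_S(y)1_S(y′)·βe^{−δd}`, `G∘∇⁺_μ, G∘∇⁻_μ ≤ 1_S1_S·β₁e^{−δd}`
(`β, β₁ ≥ 0`) on the vector carrier `X × ι`; the partition `h = h_X∘pr₁` with `|∇^±_μh_X| ≤ c₁`, `|h_X∘τ_μ − h_X| ≤ c₀`; the coefficient rows `Σ_k|A^±_μ(x)_{ik}| ≤ r_A`.  Then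
`G∘[V, M_h] ≤ 1_S(y)1_S(y′)·|J|·2·r_A·(c₁β + c₀β₁)·e^{−δd}` — the SAME letter as the left row `[V, M_h]∘G` of file 12. [cite: Balaban1984PropagatorsII, (2.134) p.247 (shape, transposed), (2.91)–(2.92) p.239 (mechanism); Balaban1985BackgroundPropagators, (3.37) p.396, (3.52) p.400 (shapes)] -/
theorem hasMaj_comp_commOp_speciesOpM {S : Set g.Site} {β β₁ c₁ c₀ rA δ : ℝ} (hβ : 0 ≤ β) (hβ₁ : 0 ≤ β₁) (hc₁ : 0 ≤ c₁) (hc₀ : 0 ≤ c₀) (hrA : 0 ≤ rA)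
    (hh1 : ∀ μ x, |fgrad n (τ μ) hX x| ≤ c₁) (hh1b : ∀ μ x, |bgrad n (τ μ) hX x| ≤ c₁) (hh0 : ∀ μ x, |hX (τ μ x) - hX x| ≤ c₀) (hA : ∀ j x i, ∑ k, |A j x i k| ≤ rA)
    (hG : HasMaj (BlockNorm.ofBlocks g (liftBlk blk ι)) (BlockNorm.ofBlocks g (liftBlk blk ι)) G (fun y y' => ind S y * ind S y' * (β * Real.exp (-(δ * g.dist y y')))))
    (hD : ∀ μ, HasMaj (BlockNorm.ofBlocks g (liftBlk blk ι)) (BlockNorm.ofBlocks g (liftBlk blk ι)) (G ∘ₗ fgrad n (liftEquiv (τ μ) ι))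
      (fun y y' => ind S y * ind S y' * (β₁ * Real.exp (-(δ * g.dist y y')))))
    (hDb : ∀ μ, HasMaj (BlockNorm.ofBlocks g (liftBlk blk ι)) (BlockNorm.ofBlocks g (liftBlk blk ι)) (G ∘ₗ bgrad n (liftEquiv (τ μ) ι))
      (fun y y' => ind S y * ind S y' * (β₁ * Real.exp (-(δ * g.dist y y'))))) :
    HasMaj (BlockNorm.ofBlocks g (liftBlk blk ι)) (BlockNorm.ofBlocks g (liftBlk blk ι)) (G ∘ₗ commOp (speciesOpM τ n C A) (fun p : X × ι => hX p.1))
      (fun y y' => ind S y * ind S y' * ((Fintype.card J * (2 * rA * (c₁ * β + c₀ * β₁))) * Real.exp (-(δ * g.dist y y')))) := by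
  -- symmetric form of the partition's difference letter
  have hh0b : ∀ μ x, |hX x - hX ((τ μ).symm x)| ≤ c₀ := fun μ x => by simpa using hh0 μ ((τ μ).symm x)
  -- rows of the four composite (scalar · matrix) coefficients
  have r1f : ∀ μ x i, ∑ k, |(bgrad n (τ μ) hX x • A (Sum.inl μ) ((τ μ).symm x)) i k| ≤ c₁ * rA := fun μ x i => sum_abs_smul_row_le hc₁ (hh1b μ x) i (hA _ _ i)
  have r2f : ∀ μ x i, ∑ k, |((hX x - hX ((τ μ).symm x)) • A (Sum.inl μ) ((τ μ).symm x)) i k| ≤ c₀ * rA := fun μ x i => sum_abs_smul_row_le hc₀ (hh0b μ x) i (hA _ _ i)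
  have r1b : ∀ μ x i, ∑ k, |(fgrad n (τ μ) hX x • A (Sum.inr μ) (τ μ x)) i k| ≤ c₁ * rA := fun μ x i => sum_abs_smul_row_le hc₁ (hh1 μ x) i (hA _ _ i)
  have r2b : ∀ μ x i, ∑ k, |((hX (τ μ x) - hX x) • A (Sum.inr μ) (τ μ x)) i k| ≤ c₀ * rA := fun μ x i => sum_abs_smul_row_le hc₀ (hh0 μ x) i (hA _ _ i)
  have hterm : ∀ μ, HasMaj (BlockNorm.ofBlocks g (liftBlk blk ι)) (BlockNorm.ofBlocks g (liftBlk blk ι))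
      (G ∘ₗ mmulOp (fun x => bgrad n (τ μ) hX x • A (Sum.inl μ) ((τ μ).symm x)) +
          (G ∘ₗ fgrad n (liftEquiv (τ μ) ι)) ∘ₗ mmulOp (fun x => (hX x - hX ((τ μ).symm x)) • A (Sum.inl μ) ((τ μ).symm x)) +
        (G ∘ₗ mmulOp (fun x => fgrad n (τ μ) hX x • A (Sum.inr μ) (τ μ x)) -
          (G ∘ₗ bgrad n (liftEquiv (τ μ) ι)) ∘ₗ mmulOp (fun x => (hX (τ μ x) - hX x) • A (Sum.inr μ) (τ μ x))))
      (fun y y' => ind S y * ind S y' * ((2 * rA * (c₁ * β + c₀ * β₁)) * Real.exp (-(δ * g.dist y y')))) := fun μ => by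
    have f1 := hasMaj_comp_mmulOp_loc blk hβ (by positivity) (r1f μ) hG
    have f2 := hasMaj_comp_mmulOp_loc blk hβ₁ (by positivity) (r2f μ) (hD μ)
    have b1 := hasMaj_comp_mmulOp_loc blk hβ (by positivity) (r1b μ) hG
    have b2 := hasMaj_comp_mmulOp_loc blk hβ₁ (by positivity) (r2b μ) (hDb μ)
    refine ((f1.add f2).add (b1.sub b2)).mono fun y y' => le_of_eq ?_
    ring
  rw [comp_commOp_speciesOpM]
  refine (hasMaj_fsum (b₁ := BlockNorm.ofBlocks g (liftBlk blk ι)) (b₃ := BlockNorm.ofBlocks g (liftBlk blk ι)) Finset.univ _ _ fun μ _ => hterm μ).mono fun y y' => le_of_eq ?_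
  simp only [Finset.sum_const, Finset.card_univ, nsmul_eq_mul]
  ring

/-- ★ THE ADJOINT ROW FOR `W = −V` (the sign of (3.53)): `G∘[−V, M_h]` has the same letter. [cite: Balaban1985BackgroundPropagators, (3.53) p.400 (shape)] -/
theorem hasMaj_comp_commOp_neg_speciesOpM {S : Set g.Site} {β β₁ c₁ c₀ rA δ : ℝ} (hβ : 0 ≤ β) (hβ₁ : 0 ≤ β₁) (hc₁ : 0 ≤ c₁) (hc₀ : 0 ≤ c₀) (hrA : 0 ≤ rA)
    (hh1 : ∀ μ x, |fgrad n (τ μ) hX x| ≤ c₁) (hh1b : ∀ μ x, |bgrad n (τ μ) hX x| ≤ c₁) (hh0 : ∀ μ x, |hX (τ μ x) - hX x| ≤ c₀) (hA : ∀ j x i, ∑ k, |A j x i k| ≤ rA)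
    (hG : HasMaj (BlockNorm.ofBlocks g (liftBlk blk ι)) (BlockNorm.ofBlocks g (liftBlk blk ι)) G (fun y y' => ind S y * ind S y' * (β * Real.exp (-(δ * g.dist y y')))))
    (hD : ∀ μ, HasMaj (BlockNorm.ofBlocks g (liftBlk blk ι)) (BlockNorm.ofBlocks g (liftBlk blk ι)) (G ∘ₗ fgrad n (liftEquiv (τ μ) ι))
      (fun y y' => ind S y * ind S y' * (β₁ * Real.exp (-(δ * g.dist y y')))))
    (hDb : ∀ μ, HasMaj (BlockNorm.ofBlocks g (liftBlk blk ι)) (BlockNorm.ofBlocks g (liftBlk blk ι)) (G ∘ₗ bgrad n (liftEquiv (τ μ) ι))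
      (fun y y' => ind S y * ind S y' * (β₁ * Real.exp (-(δ * g.dist y y'))))) :
    HasMaj (BlockNorm.ofBlocks g (liftBlk blk ι)) (BlockNorm.ofBlocks g (liftBlk blk ι)) (G ∘ₗ commOp (-speciesOpM τ n C A) (fun p : X × ι => hX p.1))
      (fun y y' => ind S y * ind S y' * ((Fintype.card J * (2 * rA * (c₁ * β + c₀ * β₁))) * Real.exp (-(δ * g.dist y y')))) := by
  rw [comp_commOp_neg]
  exact (hasMaj_comp_commOp_speciesOpM blk τ n C A hX G hβ hβ₁ hc₁ hc₀ hrA hh1 hh1b hh0 hA hG hD hDb).neg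

end Row

end Summit.QuantumFields.YangMills.BalabanUVNodes.N15.CurvedSpecies

end
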